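import Mathlib
import Summits.NavierStokesRegularity.NavierStokesRegularity.Theorems.PlaneEnergyCeilingPlanarEnergyAPrioriPressureDecaySource

/-!
# Route PlaneEnergyCeiling · crux `PlanarEnergyAPriori` · line `birth` — quadratic decay of the pressure potential

Helper file toward the registered stub `stub_decayPersistence` (order-(3,2) spatial decay persists along a
classical Leray–Hopf solution) of the crux item stmt-NavierStokesRegularity-16855 (`PlanarEnergyAPriori`),
landed `--supports` that item.

For a smooth divergence-free field `v : ℝ³ → ℝ³` with CUBIC decay of `v, Dv, D²v, D³v`,
`(1 + |y|)³ ‖Dᵏv(y)‖ ≤ C` (`k ≤ 3`), Tao's pressure potential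
`Q[v] = -Γ₀ * G[v] - (D²Γ∞) * (v ⊗ v)` (`pressurePotential`, `FluidPDE/PressureRepresentation`;
`G[v] = ∂ᵢ∂ⱼ(vᵢvⱼ)`, `Γ = Γ₀ + Γ∞` the near/far splitting of the Newtonian kernel) and its gradient decay
QUADRATICALLY: `(1 + |x|)² (|Q[v](x)| + ‖DQ[v](x)‖) ≤ K C²` with an absolute constant `K`
(`exists_pressurePotential_decay_const`). Proof: at the point `x` use the cutoff scale `R = (1 + |x|)/4`
(`pressurePotential_eq_scale`): the near kernel `Γ₀^{R,2R}` has mass `R² ∫|Γ₀^{1,2}|` and only sees the source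
`G[v]`, `|G| + ‖DG‖ ≲ C²(1 + |y|)⁻⁶`, at points `y` with `1 + |y| ≥ (1 + |x|)/2`; the far kernel obeys
`‖D²Γ∞^{R,2R}‖ ≤ M₀R⁻³`, `‖D³Γ∞^{R,2R}‖ ≤ M₁R⁻⁴` (scaling) against `∫|v|² ≤ C² ∫(1 + |y|)⁻⁶`
(the tools are in `…PressureDecaySource.lean`). Folklore potential theory (Gilbarg–Trudinger 2001,
Lemma 4.1–4.2; the `|x|⁻³`/`|x|⁻⁴` rates of the physical pressure, Brandolese 2004 = arXiv:math/0403136 §1,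
are not needed).
-/

noncomputable section

-- single-conjunct summit: `Summit.<Summit>.<Problem>` repeats the name by the D-0017 layout
set_option linter.dupNamespace false
-- nested operator types `ℝ³ →L[ℝ] ℝ³ →L[ℝ] ℝ³ →L[ℝ] ℝ` (third derivatives of the far kernel)
set_option maxSynthPendingDepth 4

namespace Summit.NavierStokesRegularity.NavierStokesRegularity.Theorems.PlanarEnergyAPriori.PressureDecay

open MeasureTheory Set Filter Metric Topology Function Real
open scoped ContDiff ENNReal
open Literature.Analysis.FluidPDE


/-! ### Quadratic decay of `Q[v]` and `DQ[v]` -/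

section Assembly

/-- Weights: `(1 + |x|)² · a/(1 + |x|)⁴ ≤ a` and `(1 + |x|)² · a/(1 + |x|)ᵐ ≤ a` for `m ≥ 2`, `a ≥ 0`. -/
theorem weight_two_mul_div_pow_le {a : ℝ} (ha : 0 ≤ a) (x : (EuclideanSpace ℝ (Fin 3))) {m : ℕ} (hm : 2 ≤ m) :
    (1 + ‖x‖) ^ 2 * (a / (1 + ‖x‖) ^ m) ≤ a := by
  have hx : 1 ≤ 1 + ‖x‖ := by simp
  have hx0 : 0 < 1 + ‖x‖ := by positivity
  rw [mul_div_assoc', div_le_iff₀ (by positivity), mul_comm]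
  exact mul_le_mul_of_nonneg_left (pow_le_pow_right₀ hx hm) ha

/-- **Quadratic decay of the pressure potential and of its gradient.** There is an absolute constant
`K` such that for every smooth divergence-free `v : ℝ³ → ℝ³` with `(1 + |y|)³ ‖Dᵏv(y)‖ ≤ C`, `k ≤ 3`,
Tao's pressure potential `Q[v] = -Δ⁻¹∂ᵢ∂ⱼ(vᵢvⱼ)` satisfies
`(1 + |x|)² |Q[v](x)| ≤ K C²` and `(1 + |x|)² ‖DQ[v](x)‖ ≤ K C²` for all `x`
(scale `R = (1 + |x|)/4` in `pressurePotential_eq_scale`; module docstring). -/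
theorem exists_pressurePotential_decay_const : ∃ K : ℝ, 0 ≤ K ∧ ∀ (C : ℝ) (v : (EuclideanSpace ℝ (Fin 3)) → (EuclideanSpace ℝ (Fin 3))), ContDiff ℝ (⊤ : ℕ∞) v → Literature.Analysis.FluidPDE.VectorCalculus.IsDivFree v → (∀ (y : (EuclideanSpace ℝ (Fin 3))) (k : ℕ), k ≤ 3 → (1 + ‖y‖) ^ 3 * ‖iteratedFDeriv ℝ k v y‖ ≤ C) → ∀ x : (EuclideanSpace ℝ (Fin 3)), (1 + ‖x‖) ^ 2 * |Literature.Analysis.FluidPDE.pressurePotential v x| ≤ K * C ^ 2 ∧ (1 + ‖x‖) ^ 2 * ‖fderiv ℝ (Literature.Analysis.FluidPDE.pressurePotential v) x‖ ≤ K * C ^ 2 := by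
  -- the absolute constants
  obtain ⟨M₀, M₁, M₂, hM₀, hM₁, -⟩ :=
    exists_bounds_fderiv2_newtonFar (r₀ := (1 : ℝ)) (r₁ := 2) one_pos one_lt_two
  obtain ⟨τ, hτ⟩ : ∃ τ : ℝ, τ = ‖(traceCLM : ((EuclideanSpace ℝ (Fin 3)) →L[ℝ] (EuclideanSpace ℝ (Fin 3))) →L[ℝ] ℝ)‖ := ⟨_, rfl⟩
  obtain ⟨J, hJ⟩ : ∃ J : ℝ, J = ∫ w : (EuclideanSpace ℝ (Fin 3)), |newtonNear 1 2 w| := ⟨_, rfl⟩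
  obtain ⟨I, hI⟩ : ∃ I : ℝ, I = ∫ y : (EuclideanSpace ℝ (Fin 3)), (1 + ‖y‖) ^ (-(6 : ℝ)) := ⟨_, rfl⟩
  have hτ0 : 0 ≤ τ := by rw [hτ]; exact norm_nonneg (traceCLM : ((EuclideanSpace ℝ (Fin 3)) →L[ℝ] (EuclideanSpace ℝ (Fin 3))) →L[ℝ] ℝ)
  have hJ0 : 0 ≤ J := by rw [hJ]; exact integral_nonneg fun w => abs_nonneg _
  have hI0 : 0 ≤ I := by rw [hI]; exact integral_nonneg fun y => by positivity
  have hM₀0 : 0 ≤ M₀ := (norm_nonneg _).trans (hM₀ 0)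
  have hM₁0 : 0 ≤ M₁ := (norm_nonneg _).trans (hM₁ 0)
  refine ⟨16 * τ * J + 64 * M₀ * I + 256 * M₁ * I, by positivity, ?_⟩
  intro C v hv hdiv hC x
  have hC0 : 0 ≤ C := const_nonneg hC
  have hv2 : ContDiff ℝ 2 v := contDiff_infty.1 hv 2
  have hGs : ContDiff ℝ 1 (pressureSource v) :=
    contDiff_pressureSource (n := 1) (by exact_mod_cast contDiff_infty.1 hv 3)
  obtain ⟨hL2, hE⟩ := integrable_norm_sq hv.continuous hC
  rw [← hI] at hE
  obtain ⟨E, hEdef⟩ : ∃ E : ℝ, E = ∫ y, ‖v y‖ ^ 2 := ⟨_, rfl⟩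
  rw [← hEdef] at hE
  have hE0 : 0 ≤ E := by rw [hEdef]; exact integral_nonneg fun y => by positivity
  -- the source bounds
  have hG0 : ∀ y, (1 + ‖y‖) ^ 6 * ‖pressureSource v y‖ ≤ 2 * τ * C ^ 2 := fun y => by
    rw [Real.norm_eq_abs, hτ]; exact (weight_six_mul_pressureSource_le hv hdiv hC y).1
  have hG1 : ∀ y, (1 + ‖y‖) ^ 6 * ‖fderiv ℝ (pressureSource v) y‖ ≤ 4 * τ * C ^ 2 := fun y => by
    rw [hτ]; exact (weight_six_mul_pressureSource_le hv hdiv hC y).2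
  -- the scale `R = (1 + |x|)/4`
  obtain ⟨R, hR⟩ : ∃ R : ℝ, R = (1 + ‖x‖) / 4 := ⟨_, rfl⟩
  have hx0 : 0 < 1 + ‖x‖ := by positivity
  have hx1 : 1 ≤ 1 + ‖x‖ := by simp
  have hRpos : 0 < R := by rw [hR]; positivity
  have hRinv : R⁻¹ = 4 / (1 + ‖x‖) := by rw [hR, inv_div]
  have h0 : (0 : ℝ) ≤ R * 1 := by linarith
  have h0' : (0 : ℝ) < R * 1 := by linarith
  have h12 : R * 1 < R * 2 := by linarith
  have hk : Integrable (newtonNear (R * 1) (R * 2)) := integrable_newtonNear h0 h12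
  have hkρ : ∀ z : (EuclideanSpace ℝ (Fin 3)), R * 2 < ‖z‖ → newtonNear (R * 1) (R * 2) z = 0 := fun z hz =>
    newtonNear_eq_zero h0 h12 hz.le
  -- the representation at scale `R`
  have hQ : pressurePotential v =
      fun x' => -nearPotential (R * 1) (R * 2) v x' - farPotential (R * 1) (R * 2) v x' :=
    funext fun x' => pressurePotential_eq_scale hRpos hv2 hL2 x'
  -- (a) the near potential and its derivative
  have hN : |nearPotential (R * 1) (R * 2) v x| ≤ 4 * (2 * τ * C ^ 2) * J / (1 + ‖x‖) ^ 4 := by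
    have h := norm_integral_newtonNear_scale_smul_le (g := pressureSource v) (by positivity) hG0 x hR
    rw [← hJ] at h
    exact h
  have hNd : HasFDerivAt (nearPotential (R * 1) (R * 2) v)
      (∫ z, newtonNear (R * 1) (R * 2) z • fderiv ℝ (pressureSource v) (x - z)) x :=
    hasFDerivAt_integral_smul_comp_sub hk hkρ hGs x
  have hN' : ‖∫ z, newtonNear (R * 1) (R * 2) z • fderiv ℝ (pressureSource v) (x - z)‖ ≤
      4 * (4 * τ * C ^ 2) * J / (1 + ‖x‖) ^ 4 := by
    have h := norm_integral_newtonNear_scale_smul_le (g := fderiv ℝ (pressureSource v))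
      (by positivity) hG1 x hR
    rw [← hJ] at h
    exact h
  -- (b) the far potential and its derivative
  have hF : |farPotential (R * 1) (R * 2) v x| ≤ R⁻¹ ^ 3 * M₀ * E := by
    rw [hEdef]; exact abs_farPotential_le hL2 (norm_fderiv2_newtonFar_scale_le hRpos hM₀) x
  obtain ⟨hFd, hF'⟩ := hasFDerivAt_farPotential h0' h12 hv.continuous hL2
    (norm_fderiv3_newtonFar_scale_le hRpos hM₁) x
  rw [← hEdef] at hF'
  -- (c) the value
  have hval : (1 + ‖x‖) ^ 2 * |pressurePotential v x| ≤ 8 * τ * J * C ^ 2 + 64 * M₀ * I * C ^ 2 := by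
    have e : pressurePotential v x =
        -nearPotential (R * 1) (R * 2) v x - farPotential (R * 1) (R * 2) v x := by rw [hQ]
    have h1 : |pressurePotential v x| ≤
        |nearPotential (R * 1) (R * 2) v x| + |farPotential (R * 1) (R * 2) v x| := by
      rw [e, show -nearPotential (R * 1) (R * 2) v x - farPotential (R * 1) (R * 2) v x =
        -(nearPotential (R * 1) (R * 2) v x + farPotential (R * 1) (R * 2) v x) by ring, abs_neg]
      exact abs_add_le _ _
    have h2 : (1 + ‖x‖) ^ 2 * |nearPotential (R * 1) (R * 2) v x| ≤ 8 * τ * J * C ^ 2 := by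
      have := weight_two_mul_div_pow_le (a := 4 * (2 * τ * C ^ 2) * J) (by positivity) x
        (m := 4) (by norm_num)
      calc (1 + ‖x‖) ^ 2 * |nearPotential (R * 1) (R * 2) v x|
          ≤ (1 + ‖x‖) ^ 2 * (4 * (2 * τ * C ^ 2) * J / (1 + ‖x‖) ^ 4) :=
            mul_le_mul_of_nonneg_left hN (by positivity)
        _ ≤ 4 * (2 * τ * C ^ 2) * J := this
        _ = 8 * τ * J * C ^ 2 := by ring
    have h3 : (1 + ‖x‖) ^ 2 * |farPotential (R * 1) (R * 2) v x| ≤ 64 * M₀ * I * C ^ 2 := by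
      have e3 : R⁻¹ ^ 3 * M₀ * E = 64 * M₀ * E / (1 + ‖x‖) ^ 3 := by
        rw [hRinv]; field_simp; ring
      have := weight_two_mul_div_pow_le (a := 64 * M₀ * E) (by positivity) x (m := 3) (by norm_num)
      calc (1 + ‖x‖) ^ 2 * |farPotential (R * 1) (R * 2) v x|
          ≤ (1 + ‖x‖) ^ 2 * (64 * M₀ * E / (1 + ‖x‖) ^ 3) := by
            rw [← e3]; exact mul_le_mul_of_nonneg_left hF (by positivity)
        _ ≤ 64 * M₀ * E := this
        _ ≤ 64 * M₀ * (C ^ 2 * I) := by gcongr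
        _ = 64 * M₀ * I * C ^ 2 := by ring
    calc (1 + ‖x‖) ^ 2 * |pressurePotential v x|
        ≤ (1 + ‖x‖) ^ 2 * (|nearPotential (R * 1) (R * 2) v x| + |farPotential (R * 1) (R * 2) v x|) :=
          mul_le_mul_of_nonneg_left h1 (by positivity)
      _ = (1 + ‖x‖) ^ 2 * |nearPotential (R * 1) (R * 2) v x| +
          (1 + ‖x‖) ^ 2 * |farPotential (R * 1) (R * 2) v x| := by ring
      _ ≤ 8 * τ * J * C ^ 2 + 64 * M₀ * I * C ^ 2 := add_le_add h2 h3
  -- (d) the gradient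
  have hgrad : (1 + ‖x‖) ^ 2 * ‖fderiv ℝ (pressurePotential v) x‖ ≤
      16 * τ * J * C ^ 2 + 256 * M₁ * I * C ^ 2 := by
    have hD : HasFDerivAt (pressurePotential v)
        (-(∫ z, newtonNear (R * 1) (R * 2) z • fderiv ℝ (pressureSource v) (x - z)) -
          ∫ y, (evalDiag (v y)).comp
            (fderiv ℝ (fderiv ℝ (fderiv ℝ (newtonFar (R * 1) (R * 2)))) (x - y))) x := by
      rw [hQ]
      exact hNd.neg.sub hFd
    rw [hD.fderiv]
    have h2 : (1 + ‖x‖) ^ 2 * ‖∫ z, newtonNear (R * 1) (R * 2) z • fderiv ℝ (pressureSource v) (x - z)‖ ≤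
        16 * τ * J * C ^ 2 := by
      have := weight_two_mul_div_pow_le (a := 4 * (4 * τ * C ^ 2) * J) (by positivity) x
        (m := 4) (by norm_num)
      calc (1 + ‖x‖) ^ 2 * ‖∫ z, newtonNear (R * 1) (R * 2) z • fderiv ℝ (pressureSource v) (x - z)‖
          ≤ (1 + ‖x‖) ^ 2 * (4 * (4 * τ * C ^ 2) * J / (1 + ‖x‖) ^ 4) :=
            mul_le_mul_of_nonneg_left hN' (by positivity)
        _ ≤ 4 * (4 * τ * C ^ 2) * J := this
        _ = 16 * τ * J * C ^ 2 := by ring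
    have h3 : (1 + ‖x‖) ^ 2 * ‖∫ y, (evalDiag (v y)).comp
        (fderiv ℝ (fderiv ℝ (fderiv ℝ (newtonFar (R * 1) (R * 2)))) (x - y))‖ ≤
        256 * M₁ * I * C ^ 2 := by
      have e3 : R⁻¹ ^ 4 * M₁ * E = 256 * M₁ * E / (1 + ‖x‖) ^ 4 := by
        rw [hRinv]; field_simp; ring
      have := weight_two_mul_div_pow_le (a := 256 * M₁ * E) (by positivity) x (m := 4) (by norm_num)
      calc (1 + ‖x‖) ^ 2 * ‖∫ y, (evalDiag (v y)).comp
            (fderiv ℝ (fderiv ℝ (fderiv ℝ (newtonFar (R * 1) (R * 2)))) (x - y))‖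
          ≤ (1 + ‖x‖) ^ 2 * (256 * M₁ * E / (1 + ‖x‖) ^ 4) := by
            rw [← e3]; exact mul_le_mul_of_nonneg_left hF' (by positivity)
        _ ≤ 256 * M₁ * E := this
        _ ≤ 256 * M₁ * (C ^ 2 * I) := by gcongr
        _ = 256 * M₁ * I * C ^ 2 := by ring
    calc _ ≤ (1 + ‖x‖) ^ 2 * (‖∫ z, newtonNear (R * 1) (R * 2) z • fderiv ℝ (pressureSource v) (x - z)‖ +
          ‖∫ y, (evalDiag (v y)).comp
            (fderiv ℝ (fderiv ℝ (fderiv ℝ (newtonFar (R * 1) (R * 2)))) (x - y))‖) := by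
          refine mul_le_mul_of_nonneg_left ?_ (by positivity)
          exact (norm_sub_le _ _).trans (by rw [norm_neg])
      _ = (1 + ‖x‖) ^ 2 * ‖∫ z, newtonNear (R * 1) (R * 2) z • fderiv ℝ (pressureSource v) (x - z)‖ +
          (1 + ‖x‖) ^ 2 * ‖∫ y, (evalDiag (v y)).comp
            (fderiv ℝ (fderiv ℝ (fderiv ℝ (newtonFar (R * 1) (R * 2)))) (x - y))‖ := by ring
      _ ≤ 16 * τ * J * C ^ 2 + 256 * M₁ * I * C ^ 2 := add_le_add h2 h3
  -- conclusion
  have hK1 : 8 * τ * J * C ^ 2 + 64 * M₀ * I * C ^ 2 ≤ (16 * τ * J + 64 * M₀ * I + 256 * M₁ * I) * C ^ 2 := by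
    nlinarith [mul_nonneg (mul_nonneg hτ0 hJ0) (sq_nonneg C), mul_nonneg (mul_nonneg hM₁0 hI0) (sq_nonneg C)]
  have hK2 : 16 * τ * J * C ^ 2 + 256 * M₁ * I * C ^ 2 ≤ (16 * τ * J + 64 * M₀ * I + 256 * M₁ * I) * C ^ 2 := by
    nlinarith [mul_nonneg (mul_nonneg hM₀0 hI0) (sq_nonneg C)]
  exact ⟨hval.trans hK1, hgrad.trans hK2⟩

end Assembly

end Summit.NavierStokesRegularity.NavierStokesRegularity.Theorems.PlanarEnergyAPriori.PressureDecay

end
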